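import Summits.QuantumFields.BalabanUV.T4Continuum.Support.NE7ApeFlatSkeleton
import Summits.QuantumFields.BalabanUV.T4Continuum.Support.NE7ApeOfLocalChartLetter
import Literature.MathematicalPhysics.QuantumFieldTheory.Balaban1983to89.B7Prop1Local
import HarnessLib

/-!
# NE7ApeFlatSkeletonLocal — F38's flat (APE) bootstrap in the LOCAL, DEFECT form the torus road to [B11] Prop. 8 needs: at a flat reference `F̃`, for a
# representative `Ũ = F̃e^{A}` that is critical only UP TO an `(ℓ¹)*`-defect `τ` against flat-tangent tests, the plaquette of `Ũ` AT A GIVEN CORNER is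
# within `K_G(τ + ρ) + ‖d_{F̃}A_N(p)‖ + 28α₀²` of `1` — the normal part's curl read POINTWISE (so a decaying lift letter can feed it), everything else as F38

Cell `pub-balaban`, rung (B)+1 sub-cell t4, lineage `b2b-balaban-t4-ne7-p1` (CRUX PROVER NE7 #1 = OWNER of row NE7), generation 88; memo
`t4/b2b-balaban-t4-ne7-p1-g88/EXISTENCE-BY-INDUCTION.md` §7 (the torus road, step (N5)).  File F245 (over F38 `NE7ApeFlatSkeleton` (§1 identities, `norm_hol_vary_flat_sub_one_le`),
F243 `NE7ApeOfLocalChartLetter.norm_plaq_sub_one_le_gaugeAct`, lit-balaban's `B7Prop1Local.hol_plaqWord_eq`).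

WHY.  Gen 88's print read (memo §0(A)): `hape` = [B11] Prop. 8, proved in Sect. F LOCALLY at a FLAT reference.  F38 (g70) typed Sect. F's composition at a flat
reference but TORUS-GLOBALLY: its representative `Ũ = F̃e^{A}` is EXACTLY tangent-critical (`hcrit`) and its normal-part letter (R7) is a GLOBAL sup (`c_N`) — two
features that do not survive localisation: the torus road (memo §7) applies the flat machinery to the CUTOFF configuration `W̃ = e^{χA}` (`A` the local Landau chart
of the critical `U` around the plaquette, `χ` a cutoff on a fixed cube), which is critical only up to a defect (commutators on the shell + the paired Euler–Lagrange
term inside) and whose lifted normal part `H♭Q(χA)` has a large curl near the shell but a small one at the centre (kernel decay of `∇H♭`).  THIS FILE is F38 §2 in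
that form: criticality + test transport merged into ONE defect letter `hcritD` («`|dAction Ũ Y| ≤ τ‖Y‖₁` for every flat-tangent `Y`»), and the normal part's curl
kept POINTWISE in the conclusion.
WHAT ([folklore]; 0 def, 0 sorry).
§1 **`norm_plaq_vary_sub_one_le_of_flatLetters_local`** — data as F38 §2 (`F̃` with `SmallField F̃ 0`, `A` skew periodic, `‖A‖ ≤ α₀`; normal part `A_N`: exact
   (`hNexact`) and hess-orthogonal (`hNorth`); slice `S ∋ A − A_N`; slice solver letter `hG` with constant `K_G`; expansion letter `hEXP` with density `ρ`) and the
   DEFECT letter `hcritD` with density `τ` ⟹ at EVERY plaquette `(z; μ ≠ ν)`: `‖Ũ(∂p) − 1‖ ≤ K_G(τ + ρ) + ‖curlAt F̃ A_N z μ ν‖ + 28α₀²`.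
§2 `hol_plaqWord_congr` (the plaquette holonomy reads only the four bonds), **`norm_plaq_sub_one_le_of_flatLetters_local_gauge`** — if a unitary gauge transform
   `U^u` of the configuration of interest AGREES with `Ũ` on the four bonds of the plaquette at `z`, then `‖U(∂p) − 1‖` obeys the same bound (F243 §1).
(F38 §2's global shape follows from §1: exact criticality + the transport letter give `hcritD` with the same `τ` — not re-stated, it is F38's theorem.)
HONEST FRAMING (page 1): composition over HYPOTHESES (the letters are F38's, asserted for nothing); this is the SPINE of step (N5) of the torus road, not (N1)–(N4);
nothing of Bałaban's asserted; NOT (APE), NOT ONE-STEP, NOT NE7; spine 0∕9; finite T⁴ rung (B)+1 — NOT infinite volume, NOT mass gap, NOT `BetaPertH`, NOT Clay.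
Continuum YM on T⁴ ⇐ BetaPertH ∧ nine spine estimates (0/9 proved); BetaPertH ⇐ (D1) ∧ (D4) ∧ CAP+tail; G-an2-4 gates asym, D1 and NE2/3/4.
-/

set_option autoImplicit false

open scoped BigOperators Matrix.Norms.L2Operator
open NormedSpace Finset Set

namespace Summit.QuantumFields.BalabanUV.T4Continuum.NE7ApeFlatSkeletonLocal

open Literature.MathematicalPhysics.QuantumFieldTheory.Balaban1983to89
open B7Prop1Explicit B7Prop2Explicit MatrixLog UnitaryModel
open B7Prop1Local (hol_plaqWord_eq)
open T4AveragingDeficitWall (IsUnitaryCfg IsSkewDir SmallField vary curlAt dirL1)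
open T4AveragingDeficitWallBoundary (IsPeriodicCfg periodBox)
open AveragingDeficitPeriodicCounting (IsPeriodicDir)
open AveragingDeficitMultiLevelPrep (LevelSmall)
open MinimalActionLevels (perWin)
open NE3HessForm (hess dAction)
open NE3TangentCovariantTower (dirIter)
open NE3ResidualSliceRep (dirIter_sub)
open NE3EnergyHessBilin (hess_add_left)
open NE3EnergyShapes (IsUnitarySite)
open NE7ExactCurrent (dAction_add)
open NE7ApeFlatSkeleton (norm_hol_vary_flat_sub_one_le curlAt_eq_add_of_split)
open NE7ApeOfLocalChartLetter (norm_plaq_sub_one_le_gaugeAct)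

noncomputable section

variable {d : ℕ} {n : Type*} [Fintype n] [DecidableEq n]

/-! ## §1 The flat bootstrap with a criticality DEFECT, normal curl POINTWISE -/

/-- **THE FLAT BOOTSTRAP, LOCAL DEFECT FORM** ([Balaban1985Variational] Sect. F (159)–(167) at a flat reference, as F38 §2, with criticality replaced by an
`(ℓ¹)*`-defect and the normal part's curl read pointwise): for `Ũ = F̃e^{A}` with the letters of the docstring and every plaquette corner `z`, plane `μ ≠ ν`:
`‖Ũ(∂p_{μν}(z)) − 1‖ ≤ K_G(τ + ρ) + ‖curlAt F̃ A_N z μ ν‖ + 28α₀²`. [folklore] -/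
theorem norm_plaq_vary_sub_one_le_of_flatLetters_local [Nonempty n] {L : ℕ} (hL : 1 ≤ L) (k : ℕ) {P : ℕ}
    {Ft : Site d → Fin d → (Matrix n n ℂ)ˣ} (hFt : IsUnitaryCfg Ft) (hFt0 : SmallField Ft 0)
    {x : ℝ} (hx : 0 ≤ x) (hs : LevelSmall d L k x) (hFtx : SmallField Ft x)
    {A : Site d → Fin d → Matrix n n ℂ} (hA : IsSkewDir A) (hAP : IsPeriodicDir A (P : ℤ)) {α₀ : ℝ} (hAα : ∀ y μ, ‖A y μ‖ ≤ α₀)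
    -- the normal part: exactness and (R⊥) output
    {AN : Site d → Fin d → Matrix n n ℂ} (hNs : IsSkewDir AN) (hNP : IsPeriodicDir AN (P : ℤ))
    (hNexact : dirIter L (k + 1) Ft AN = dirIter L (k + 1) Ft A)
    (hNorth : ∀ Y : Site d → Fin d → Matrix n n ℂ, IsSkewDir Y → IsPeriodicDir Y (P : ℤ) → dirIter L (k + 1) Ft Y = 0 →
      hess Ft AN Y (perWin d P) = 0)
    -- the gauge slice and the slice solver letter
    (S : Set (Site d → Fin d → Matrix n n ℂ)) (hTS : (fun y μ => A y μ - AN y μ) ∈ S) {KG : ℝ}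
    (hG : ∀ X ∈ S, IsSkewDir X → IsPeriodicDir X (P : ℤ) → dirIter L (k + 1) Ft X = 0 → ∀ g : ℝ, 0 ≤ g →
      (∀ Y : Site d → Fin d → Matrix n n ℂ, IsSkewDir Y → IsPeriodicDir Y (P : ℤ) → dirIter L (k + 1) Ft Y = 0 →
        |hess Ft X Y (perWin d P)| ≤ g * dirL1 Y (periodBox (d := d) P)) →
      ∀ z μ ν, μ ≠ ν → ‖curlAt Ft X z μ ν‖ ≤ KG * g)
    -- the expansion letter
    {ρ : ℝ} (hρ : 0 ≤ ρ)
    (hEXP : ∀ Y : Site d → Fin d → Matrix n n ℂ, IsSkewDir Y → IsPeriodicDir Y (P : ℤ) →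
      |dAction (vary Ft A 1) Y (perWin d P) - hess Ft A Y (perWin d P)| ≤ ρ * dirL1 Y (periodBox (d := d) P))
    -- criticality of the representative UP TO A DEFECT, tested against FLAT-tangent directions
    {τ : ℝ} (hτ : 0 ≤ τ)
    (hcritD : ∀ Y : Site d → Fin d → Matrix n n ℂ, IsSkewDir Y → IsPeriodicDir Y (P : ℤ) → dirIter L (k + 1) Ft Y = 0 →
      |dAction (vary Ft A 1) Y (perWin d P)| ≤ τ * dirL1 Y (periodBox (d := d) P))
    (z : Site d) {μ ν : Fin d} (hμν : μ ≠ ν) :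
    ‖((hol (vary Ft A 1) z (plaqWord μ ν) : (Matrix n n ℂ)ˣ) : Matrix n n ℂ) - 1‖ ≤ KG * (τ + ρ) + ‖curlAt Ft AN z μ ν‖ + 28 * α₀ ^ 2 := by
  -- the tangent part
  set X : Site d → Fin d → Matrix n n ℂ := fun y μ => A y μ - AN y μ with hXdef
  have hXs : IsSkewDir X := fun y μ => (skewAdjoint (Matrix n n ℂ)).sub_mem (hA y μ) (hNs y μ)
  have hXP : IsPeriodicDir X (P : ℤ) := fun y i μ => by simp only [hXdef, hAP y i μ, hNP y i μ]
  have hXT : dirIter L (k + 1) Ft X = 0 := by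
    rw [hXdef, dirIter_sub hL k hFt hx hs hFtx A AN, hNexact]
    funext z κ
    simp
  -- the source density on the tangent space
  have hsrc : ∀ Y : Site d → Fin d → Matrix n n ℂ, IsSkewDir Y → IsPeriodicDir Y (P : ℤ) → dirIter L (k + 1) Ft Y = 0 →
      |hess Ft X Y (perWin d P)| ≤ (τ + ρ) * dirL1 Y (periodBox (d := d) P) := by
    intro Y hY hYP hYT
    have hsplitA : A = X + AN := by funext y μ; simp [hXdef]
    have hhess : hess Ft X Y (perWin d P) = hess Ft A Y (perWin d P) := by
      have h := hess_add_left Ft (perWin d P) X AN Y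
      rw [← hsplitA, hNorth Y hY hYP hYT, add_zero] at h
      exact h.symm
    have hdA := hcritD Y hY hYP hYT
    have hE := hEXP Y hY hYP
    have htri : |hess Ft A Y (perWin d P)| ≤ |dAction (vary Ft A 1) Y (perWin d P)|
        + |dAction (vary Ft A 1) Y (perWin d P) - hess Ft A Y (perWin d P)| := by
      have := abs_sub_abs_le_abs_sub (hess Ft A Y (perWin d P)) (dAction (vary Ft A 1) Y (perWin d P))
      rw [abs_sub_comm] at this
      linarith
    rw [hhess]
    calc |hess Ft A Y (perWin d P)| ≤ τ * dirL1 Y (periodBox (d := d) P) + ρ * dirL1 Y (periodBox (d := d) P) := by linarith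
      _ = (τ + ρ) * dirL1 Y (periodBox (d := d) P) := by ring
  -- the slice solver bounds the tangent part's curl everywhere
  have hcurlX : ∀ z μ ν, μ ≠ ν → ‖curlAt Ft X z μ ν‖ ≤ KG * (τ + ρ) :=
    hG X hTS hXs hXP hXT (τ + ρ) (add_nonneg hτ hρ) hsrc
  -- the curl of `A` at the given plaquette
  have hsplit : ∀ y κ, A y κ = X y κ + AN y κ := fun y κ => by simp [hXdef]
  have hXz := hcurlX z μ ν hμν
  have hsplitz : curlAt Ft A z μ ν = curlAt Ft X z μ ν + curlAt Ft AN z μ ν := curlAt_eq_add_of_split Ft hsplit z μ ν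
  have hnorm : ‖curlAt Ft X z μ ν + curlAt Ft AN z μ ν‖ ≤ ‖curlAt Ft X z μ ν‖ + ‖curlAt Ft AN z μ ν‖ := norm_add_le _ _
  have hcurlA : ‖curlAt Ft A z μ ν‖ ≤ KG * (τ + ρ) + ‖curlAt Ft AN z μ ν‖ := by
    rw [hsplitz]; linarith
  have h := norm_hol_vary_flat_sub_one_le hFt hFt0 hA hAα z hμν
  linarith

/-! ## §2 Reading the plaquette of the configuration of interest through a gauge that matches the representative on four bonds -/

section Congr

variable {G : Type*} [Group G]

/-- The plaquette holonomy reads only the four bonds of the plaquette. [folklore] -/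
theorem hol_plaqWord_congr {V W : Site d → Fin d → G} {z : Site d} {μ ν : Fin d} (h1 : V z μ = W z μ) (h2 : V (z + e μ) ν = W (z + e μ) ν)
    (h3 : V (z + e ν) μ = W (z + e ν) μ) (h4 : V z ν = W z ν) : hol V z (plaqWord μ ν) = hol W z (plaqWord μ ν) := by
  rw [hol_plaqWord_eq, hol_plaqWord_eq, h1, h2, h3, h4]

end Congr

/-- **THE SAME BOUND FOR A CONFIGURATION `U` WHOSE GAUGE TRANSFORM MATCHES THE REPRESENTATIVE ON THE PLAQUETTE**: if `u` is a unitary gauge and `U^u` agrees with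
`Ũ = F̃e^{A}` on the four bonds of the plaquette at `z` (the situation of the torus road: `U^u = e^{A}` on the cube, `Ũ = e^{χA}`, `χ = 1` near `z`), then under the
letters of §1 `‖U(∂p_{μν}(z)) − 1‖ ≤ K_G(τ + ρ) + ‖curlAt F̃ A_N z μ ν‖ + 28α₀²`. [folklore] -/
theorem norm_plaq_sub_one_le_of_flatLetters_local_gauge [Nonempty n] {L : ℕ} (hL : 1 ≤ L) (k : ℕ) {P : ℕ}
    {Ft : Site d → Fin d → (Matrix n n ℂ)ˣ} (hFt : IsUnitaryCfg Ft) (hFt0 : SmallField Ft 0)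
    {x : ℝ} (hx : 0 ≤ x) (hs : LevelSmall d L k x) (hFtx : SmallField Ft x)
    {A : Site d → Fin d → Matrix n n ℂ} (hA : IsSkewDir A) (hAP : IsPeriodicDir A (P : ℤ)) {α₀ : ℝ} (hAα : ∀ y μ, ‖A y μ‖ ≤ α₀)
    {AN : Site d → Fin d → Matrix n n ℂ} (hNs : IsSkewDir AN) (hNP : IsPeriodicDir AN (P : ℤ))
    (hNexact : dirIter L (k + 1) Ft AN = dirIter L (k + 1) Ft A)
    (hNorth : ∀ Y : Site d → Fin d → Matrix n n ℂ, IsSkewDir Y → IsPeriodicDir Y (P : ℤ) → dirIter L (k + 1) Ft Y = 0 →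
      hess Ft AN Y (perWin d P) = 0)
    (S : Set (Site d → Fin d → Matrix n n ℂ)) (hTS : (fun y μ => A y μ - AN y μ) ∈ S) {KG : ℝ}
    (hG : ∀ X ∈ S, IsSkewDir X → IsPeriodicDir X (P : ℤ) → dirIter L (k + 1) Ft X = 0 → ∀ g : ℝ, 0 ≤ g →
      (∀ Y : Site d → Fin d → Matrix n n ℂ, IsSkewDir Y → IsPeriodicDir Y (P : ℤ) → dirIter L (k + 1) Ft Y = 0 →
        |hess Ft X Y (perWin d P)| ≤ g * dirL1 Y (periodBox (d := d) P)) →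
      ∀ z μ ν, μ ≠ ν → ‖curlAt Ft X z μ ν‖ ≤ KG * g)
    {ρ : ℝ} (hρ : 0 ≤ ρ)
    (hEXP : ∀ Y : Site d → Fin d → Matrix n n ℂ, IsSkewDir Y → IsPeriodicDir Y (P : ℤ) →
      |dAction (vary Ft A 1) Y (perWin d P) - hess Ft A Y (perWin d P)| ≤ ρ * dirL1 Y (periodBox (d := d) P))
    {τ : ℝ} (hτ : 0 ≤ τ)
    (hcritD : ∀ Y : Site d → Fin d → Matrix n n ℂ, IsSkewDir Y → IsPeriodicDir Y (P : ℤ) → dirIter L (k + 1) Ft Y = 0 →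
      |dAction (vary Ft A 1) Y (perWin d P)| ≤ τ * dirL1 Y (periodBox (d := d) P))
    -- the configuration of interest and a gauge matching the representative on the plaquette
    {U : Site d → Fin d → (Matrix n n ℂ)ˣ} {u : Site d → (Matrix n n ℂ)ˣ} (hu : IsUnitarySite u)
    (z : Site d) {μ ν : Fin d} (hμν : μ ≠ ν)
    (h1 : gaugeAct u U z μ = vary Ft A 1 z μ) (h2 : gaugeAct u U (z + e μ) ν = vary Ft A 1 (z + e μ) ν)
    (h3 : gaugeAct u U (z + e ν) μ = vary Ft A 1 (z + e ν) μ) (h4 : gaugeAct u U z ν = vary Ft A 1 z ν) :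
    ‖((hol U z (plaqWord μ ν) : (Matrix n n ℂ)ˣ) : Matrix n n ℂ) - 1‖ ≤ KG * (τ + ρ) + ‖curlAt Ft AN z μ ν‖ + 28 * α₀ ^ 2 := by
  have hrep := norm_plaq_vary_sub_one_le_of_flatLetters_local hL k hFt hFt0 hx hs hFtx hA hAP hAα hNs hNP hNexact hNorth S hTS hG hρ hEXP hτ hcritD
    z hμν
  have hg := norm_plaq_sub_one_le_gaugeAct (U := U) hu z μ ν
  rw [hol_plaqWord_congr h1 h2 h3 h4] at hg
  exact hg.trans hrep

end

end Summit.QuantumFields.BalabanUV.T4Continuum.NE7ApeFlatSkeletonLocal
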